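import Mathlib.Analysis.SpecialFunctions.Pow.Real
import HarnessLib

/-!
# The reverse-Harris rows `P3_λ` (`λ ≥ 4/3`, in particular the SHARP row `P3⅔`, `λ = 3/2`) are closed under gluing a terminal–terminal edge

Support file for crux `stmt-CriticalPhenomena-4575` (`NoHeavyLowerTail`), seat `prim-l12-p1` gen 31 (`--supports stmt-CriticalPhenomena-4575`;
memo `run/shared/lean/prim/prim-l12/FROM-prim-l12-p1-g31-P3-SHARP-ROW-STABILITY.md`, §3).  No definitions, no sorries, standard axioms.
Companion of `…SuperTerminalP3HalfStable` (lead g134, THEOREM C: the face row `P3½` = `P3_2` is stable under parallel composition at `{s,a,b,c}`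
modulo the tropical law).  For the sharp constant `λ = 3/2` that two-piece stability is FALSE for abstract laws, even modulo every catalogued
3- and 4-point law (memo §2, exact rational counterexamples); what survives at the abstract level is this file: the second piece may be ANY
single terminal–terminal edge.

Setting (cells as in `…SuperTerminalQuarticOrdered` / `…SuperTerminalP3HalfStable`).  A 4-terminal piece has partition-law cells
`n = P(s|a|b|c)`, `σ = P(sa|b|c)`, `ζ = P(sa|bc)`, `τ = P(sac|b)`, `β = P(bc|s|a)`, `ξs = P(sc|a|b)`, `ξa = P(ac|s|b)`, `γ = P(c singleton)` (total mass one,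
so `γ ≤ 1`).  The row `P3_λ : μ(F)·μ(c↔T) ≤ λ·μ(F ∩ c↔T)` (`F = {s↔a}∩{s↮b}`, `T = {s,a,b}`) reads `(σ+ζ+τ)(1−γ) ≤ λ(ζ+τ)`.
Gluing an edge `e = {x,y}` of weight `w` between two terminals is parallel composition with the two-atom piece `(1−w)·δ_{s|a|b|c} + w·δ_{xy}`; by the
join rule the composite law is `(1−w)·(law) + w·(law with x,y merged)`, and merging acts on the cells by
* `e = bc`: `σ ↦ ζ`, `ζ ↦ ζ`, `τ, ξs, ξa ↦` (not in `F`), `γ ↦ 0`:  `μ(F∘) = (1−w)(σ+ζ+τ) + w(σ+ζ)`, `μ(F∘ ∩ c↔T) = (1−w)(ζ+τ) + w(σ+ζ)`, `γ∘ = (1−w)γ`;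
* `e = sc`: `σ, ξa ↦ τ`, `τ ↦ τ`, `ζ ↦` (not in `F`), `γ ↦ 0`:  `μ(F∘) = (1−w)(σ+ζ+τ) + w(σ+τ+ξa)`, `μ(F∘ ∩ c↔T) = (1−w)(ζ+τ) + w(σ+τ+ξa)`, `γ∘ = (1−w)γ`
  (`e = ac` is the same with `ξs` in place of `ξa`, by the `s ↔ a` symmetry of `F`);
* `e = sa`: `n ↦ σ`, `β ↦ ζ`, `ξs, ξa ↦ τ`, `γ ↦ γ`:  `μ(F∘) = (1−w)(σ+ζ+τ) + w(n+σ+S)`, `μ(F∘ ∩ c↔T) = (1−w)(ζ+τ) + w·S`, `S = ζ+τ+β+ξs+ξa`, `γ∘ = γ`;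
* `e = sb` or `ab`: every `F`-cell leaves `F`, `γ ↦ γ`:  `μ(F∘) = (1−w)(σ+ζ+τ)`, `μ(F∘ ∩ c↔T) = (1−w)(ζ+τ)`, `γ∘ = γ`.

RESULTS.  `edge_core` — the one real inequality behind the cases `bc, sc, ac`: for `ρ = λ − 1 ≥ 1/3` the row survives; the constant is SHARP
(memo §3: for every `λ < 4/3` an abstract `P3_λ`-tight piece and a `bc`-edge violate it), and the proof is the completed square
`ρ² + ργ − γ + γ² = (γ − (1−ρ)/2)² + (3ρ−1)(ρ+1)/4`.  `p3_bcEdge`, `p3_scEdge`, `p3_acEdge` (any `λ ≥ 4/3`), `p3_saEdge` (any `λ`, GIVEN the 3-point row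
of the piece with `s, a` identified — for `λ = 3/2` and a graph piece that is the face inequality `(C½)` `ThreePointIsoSexticUniversal.faceHalf_all`, a theorem),
`p3_sbEdge` (any `λ ≥ 0`; also covers `ab`).  Consequence (graph level, by the join rule `PartitionLatticeGluing.real_partLE`): a minimal counterexample to the
sharp row `P3⅔` spans no terminal–terminal edge.
-/

namespace Summit.CriticalPhenomena.PercolationContinuityZ3.Theorems.SuperTerminalP3TermEdges

/-- **Core inequality.**  `ρ ≥ 1/3`, `σ, g ≥ 0`, `γ ≥ 0`, `0 ≤ w ≤ 1`, `D ≤ g`, and the row `(σ+g)(1−γ) ≤ (1+ρ)·g`.  Then with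
`A₁ := σ + g − D` (the `F`-mass of the merged law, all of it inside `{c↔T}`):
`((1−w)(σ+g) + w·A₁)·(1 − (1−w)γ) ≤ (1+ρ)·((1−w)g + w·A₁)`.
Proof: the slack is `(1−w)Ψ + wρA₁ − w(1−w)γD` (`Ψ` = row slack); with `D ≤ g` it is at least `(1−w)g(ρ+γ(1−w)) + σ(wρ−(1−w)(1−γ))`; if the last bracket is
negative, `σ ≤ g(ρ+γ)/(1−γ)` from the row leaves `g·w·(ρ(ρ+γ) − (1−w)γ(1−γ))/(1−γ) ≥ g·w·(ρ²+ργ−γ+γ²)/(1−γ) ≥ 0`. [this work] -/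
theorem edge_core {ρ σ g γ w D : ℝ} (hρ : 1 / 3 ≤ ρ) (hσ : 0 ≤ σ) (hg : 0 ≤ g) (hγ0 : 0 ≤ γ)
    (hw0 : 0 ≤ w) (hw1 : w ≤ 1) (hD : D ≤ g) (hrow : (σ + g) * (1 - γ) ≤ (1 + ρ) * g) :
    ((1 - w) * (σ + g) + w * (σ + g - D)) * (1 - (1 - w) * γ) ≤ (1 + ρ) * ((1 - w) * g + w * (σ + g - D)) := by
  -- reduce to `D = g` (the slack is non-increasing in `D`)
  have hred : ((1 - w) * (σ + g) + w * (σ + g - D)) * (1 - (1 - w) * γ) - (1 + ρ) * ((1 - w) * g + w * (σ + g - D)) ≤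
      ((1 - w) * (σ + g) + w * σ) * (1 - (1 - w) * γ) - (1 + ρ) * ((1 - w) * g + w * σ) := by
    have h1 : 0 ≤ w * (g - D) := mul_nonneg hw0 (by linarith)
    have h2 : (1 - (1 - w) * γ) ≤ 1 + ρ := by nlinarith
    nlinarith [mul_le_mul_of_nonneg_left h2 h1]
  -- the case `D = g`
  have key : ((1 - w) * (σ + g) + w * σ) * (1 - (1 - w) * γ) ≤ (1 + ρ) * ((1 - w) * g + w * σ) := by
    by_cases hc : (1 - w) * (1 - γ) ≤ w * ρ
    · -- both `σ`- and `g`-coefficients of the slack are nonnegative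
      have e : (1 + ρ) * ((1 - w) * g + w * σ) - ((1 - w) * (σ + g) + w * σ) * (1 - (1 - w) * γ) =
          (1 - w) * g * (ρ + γ * (1 - w)) + σ * (w * ρ - (1 - w) * (1 - γ)) := by ring
      have t1 : 0 ≤ (1 - w) * g * (ρ + γ * (1 - w)) := by
        have h1 : 0 ≤ ρ + γ * (1 - w) := by nlinarith
        have h2 : 0 ≤ (1 - w) * g := mul_nonneg (by linarith) hg
        exact mul_nonneg h2 h1
      have t2 : 0 ≤ σ * (w * ρ - (1 - w) * (1 - γ)) := mul_nonneg hσ (by linarith)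
      linarith
    · -- here `1 - γ > 0`; use `σ(1−γ) ≤ g(ρ+γ)` from the row and the completed square
      rw [not_le] at hc
      have hγlt : 0 < 1 - γ := by
        by_contra h
        rw [not_lt] at h
        have : (1 - w) * (1 - γ) ≤ 0 := mul_nonpos_of_nonneg_of_nonpos (by linarith) h
        have : 0 ≤ w * ρ := mul_nonneg hw0 (by linarith)
        linarith
      have hsg : σ * (1 - γ) ≤ g * (ρ + γ) := by nlinarith
      -- slack·(1−γ) ≥ g·w·[(γ − (1−ρ)/2)² + (3ρ−1)(ρ+1)/4]·… ; we let `nlinarith` assemble it from the pieces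
      have sq : 0 ≤ ρ ^ 2 + ρ * γ - γ + γ ^ 2 := by nlinarith [sq_nonneg (γ - (1 - ρ) / 2)]
      have hwg : 0 ≤ w * g := mul_nonneg hw0 hg
      have cneg : 0 ≤ (1 - w) * (1 - γ) - w * ρ := by linarith
      have e : (1 - γ) * ((1 + ρ) * ((1 - w) * g + w * σ) - ((1 - w) * (σ + g) + w * σ) * (1 - (1 - w) * γ)) =
          ((1 - w) * (1 - γ) - w * ρ) * (g * (ρ + γ) - σ * (1 - γ)) + w * g * (ρ ^ 2 + ρ * γ - γ + γ ^ 2) +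
          w ^ 2 * g * γ * (1 - γ) := by ring
      have pos : 0 ≤ (1 - γ) * ((1 + ρ) * ((1 - w) * g + w * σ) - ((1 - w) * (σ + g) + w * σ) * (1 - (1 - w) * γ)) := by
        rw [e]
        have a1 : 0 ≤ ((1 - w) * (1 - γ) - w * ρ) * (g * (ρ + γ) - σ * (1 - γ)) := mul_nonneg cneg (by linarith)
        have a2 : 0 ≤ w * g * (ρ ^ 2 + ρ * γ - γ + γ ^ 2) := mul_nonneg hwg sq
        have a3 : 0 ≤ w ^ 2 * g * γ * (1 - γ) := by
          have := mul_nonneg (mul_nonneg (mul_nonneg (sq_nonneg w) hg) hγ0) hγlt.le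
          simpa [mul_assoc] using this
        linarith
      by_contra hlt
      rw [not_le] at hlt
      have : (1 - γ) * ((1 + ρ) * ((1 - w) * g + w * σ) - ((1 - w) * (σ + g) + w * σ) * (1 - (1 - w) * γ)) < 0 :=
        mul_neg_of_pos_of_neg hγlt (by linarith)
      linarith
  linarith

/-- **`bc`-edge.**  `λ ≥ 4/3`; a piece with cells `σ, ζ, τ ≥ 0`, `γ ≥ 0` satisfying `P3_λ`: `(σ+ζ+τ)(1−γ) ≤ λ(ζ+τ)`; glue an edge `b–c` of weight
`w ∈ [0,1]`.  Then the composite satisfies `P3_λ`: `((1−w)(σ+ζ+τ) + w(σ+ζ))·(1 − (1−w)γ) ≤ λ·((1−w)(ζ+τ) + w(σ+ζ))`. [this work] -/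
theorem p3_bcEdge {lam σ ζ τ γ w : ℝ} (hlam : 4 / 3 ≤ lam) (hσ : 0 ≤ σ) (hζ : 0 ≤ ζ) (hτ : 0 ≤ τ) (hγ0 : 0 ≤ γ)
    (hw0 : 0 ≤ w) (hw1 : w ≤ 1) (hrow : (σ + ζ + τ) * (1 - γ) ≤ lam * (ζ + τ)) :
    ((1 - w) * (σ + ζ + τ) + w * (σ + ζ)) * (1 - (1 - w) * γ) ≤ lam * ((1 - w) * (ζ + τ) + w * (σ + ζ)) := by
  have h := edge_core (ρ := lam - 1) (σ := σ) (g := ζ + τ) (γ := γ) (w := w) (D := τ) (by linarith) hσ (by positivity) hγ0 hw0 hw1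
    (by linarith) (by convert hrow using 1 <;> ring)
  convert h using 1 <;> ring

/-- **`sc`-edge.**  `λ ≥ 4/3`; cells `σ, ζ, τ, ξa ≥ 0`, `γ ≥ 0`, `P3_λ` for the piece; glue an edge `s–c` of weight `w ∈ [0,1]` (merging sends
`σ` and `ξa` into `τ` and removes `ζ` from `F`).  Then `((1−w)(σ+ζ+τ) + w(σ+τ+ξa))·(1 − (1−w)γ) ≤ λ·((1−w)(ζ+τ) + w(σ+τ+ξa))`. [this work] -/
theorem p3_scEdge {lam σ ζ τ ξa γ w : ℝ} (hlam : 4 / 3 ≤ lam) (hσ : 0 ≤ σ) (hζ : 0 ≤ ζ) (hτ : 0 ≤ τ) (hξa : 0 ≤ ξa) (hγ0 : 0 ≤ γ)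
    (hw0 : 0 ≤ w) (hw1 : w ≤ 1) (hrow : (σ + ζ + τ) * (1 - γ) ≤ lam * (ζ + τ)) :
    ((1 - w) * (σ + ζ + τ) + w * (σ + τ + ξa)) * (1 - (1 - w) * γ) ≤ lam * ((1 - w) * (ζ + τ) + w * (σ + τ + ξa)) := by
  have h := edge_core (ρ := lam - 1) (σ := σ) (g := ζ + τ) (γ := γ) (w := w) (D := ζ - ξa) (by linarith) hσ (by positivity) hγ0
    hw0 hw1 (by linarith) (by convert hrow using 1 <;> ring)
  convert h using 1 <;> ring

/-- **`ac`-edge** (the `s ↔ a` mirror of `p3_scEdge`: merging `a, c` sends `σ` and `ξs` into `τ`).  `λ ≥ 4/3`. [this work] -/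
theorem p3_acEdge {lam σ ζ τ ξs γ w : ℝ} (hlam : 4 / 3 ≤ lam) (hσ : 0 ≤ σ) (hζ : 0 ≤ ζ) (hτ : 0 ≤ τ) (hξs : 0 ≤ ξs) (hγ0 : 0 ≤ γ)
    (hw0 : 0 ≤ w) (hw1 : w ≤ 1) (hrow : (σ + ζ + τ) * (1 - γ) ≤ lam * (ζ + τ)) :
    ((1 - w) * (σ + ζ + τ) + w * (σ + τ + ξs)) * (1 - (1 - w) * γ) ≤ lam * ((1 - w) * (ζ + τ) + w * (σ + τ + ξs)) :=
  p3_scEdge hlam hσ hζ hτ hξs hγ0 hw0 hw1 hrow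

/-- **`sa`-edge.**  Any `λ`; cells `n, σ, ζ, τ ≥ 0`, `S ≥ ζ + τ` (`S = ζ+τ+β+ξs+ξa`), `γ ≤ 1`; hypotheses: `P3_λ` for the piece AND the 3-point row of the piece
with `s, a` identified: `(n+σ+S)(1−γ) ≤ λ·S` (for `λ = 3/2` and a graph piece this is the face inequality `(C½)`, `ThreePointIsoSexticUniversal.faceHalf_all`).
Glue an edge `s–a` of weight `w ∈ [0,1]`; then `((1−w)(σ+ζ+τ) + w(n+σ+S))(1−γ) ≤ λ((1−w)(ζ+τ) + w·S)` — a convex combination of the two hypotheses. [this work] -/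
theorem p3_saEdge {lam n σ ζ τ S γ w : ℝ} (hw0 : 0 ≤ w) (hw1 : w ≤ 1)
    (hrow : (σ + ζ + τ) * (1 - γ) ≤ lam * (ζ + τ)) (hrow3 : (n + σ + S) * (1 - γ) ≤ lam * S) :
    ((1 - w) * (σ + ζ + τ) + w * (n + σ + S)) * (1 - γ) ≤ lam * ((1 - w) * (ζ + τ) + w * S) := by
  have h1 := mul_le_mul_of_nonneg_left hrow (show 0 ≤ 1 - w by linarith)
  have h2 := mul_le_mul_of_nonneg_left hrow3 hw0
  nlinarith [h1, h2]

/-- **`sb`-edge (and `ab`-edge).**  `λ ≥ 0`; merging `s, b` (or `a, b`) empties `F` and leaves `γ` unchanged, so the composite row is `(1−w)` times the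
piece's row: `((1−w)(σ+ζ+τ))(1−γ) ≤ λ((1−w)(ζ+τ))`. [this work] -/
theorem p3_sbEdge {lam σ ζ τ γ w : ℝ} (hw1 : w ≤ 1) (hrow : (σ + ζ + τ) * (1 - γ) ≤ lam * (ζ + τ)) :
    ((1 - w) * (σ + ζ + τ)) * (1 - γ) ≤ lam * ((1 - w) * (ζ + τ)) := by
  have h1 := mul_le_mul_of_nonneg_left hrow (show 0 ≤ 1 - w by linarith)
  nlinarith [h1]

/-- **Sharpness of `4/3`.**  Below `4/3` the `bc`-edge closure fails from the row alone: for `λ = 6/5` the abstract piece `σ = τ = 1/10`, `ζ = 0`,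
`γ = 2/5` (admissible: `σ ≤ γ`, total mass `≤ 1`) is `P3_λ`-tight, and gluing a `b–c` edge of weight `2/5` violates `P3_λ`
(for every `λ < 4/3` such pieces exist: `ρ² + ργ − γ + γ² < 0` has a solution `γ ∈ (0,1)` iff `ρ < 1/3`). [this work] -/
theorem bcEdge_sharp : ∃ lam σ ζ τ γ w : ℝ, 1 < lam ∧ lam < 4 / 3 ∧ 0 ≤ σ ∧ 0 ≤ ζ ∧ 0 ≤ τ ∧ 0 ≤ γ ∧ γ ≤ 1 ∧ σ + ζ + τ + γ ≤ 1 ∧ σ ≤ γ ∧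
    0 ≤ w ∧ w ≤ 1 ∧ (σ + ζ + τ) * (1 - γ) ≤ lam * (ζ + τ) ∧
    lam * ((1 - w) * (ζ + τ) + w * (σ + ζ)) < ((1 - w) * (σ + ζ + τ) + w * (σ + ζ)) * (1 - (1 - w) * γ) := by
  refine ⟨6 / 5, 1 / 10, 0, 1 / 10, 2 / 5, 2 / 5, ?_⟩
  norm_num

end Summit.CriticalPhenomena.PercolationContinuityZ3.Theorems.SuperTerminalP3TermEdges
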